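import Mathlib
import Summits.NavierStokesRegularity.NavierStokesRegularity.Theorems.TaoLadderRungTwoBreakOneShiftT4W76TermPres
import Summits.NavierStokesRegularity.NavierStokesRegularity.Theorems.TaoLadderRungTwoBreakOneShiftT4W76RRows
import HarnessLib

/-!
# The one-shift instance T4 @ ε₀ = 1/10, W = 76, REPLAY-SIZED VARIANT (R): ITS TERM-DATA PRESENTATION is the UNCHANGED
# `T4W76.presT4 cb` — the variant frame `T4W76R.frame bd` matches it (cell harvest/h2-tao-ladder, seat p2;
# rung1/RUNG1-P2G16-REPORT.md §79, rung1/KERNEL-CHEAP-REPLAY-SPEC.md §9 (I); support for K1(1) = `NoSurvivingDSSOne`,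
# stmt-NavierStokesRegularity-20205)

MODEL lattice only (comparable circuit table T4, scale ratio `11/10`); nothing here is a statement about the
Navier–Stokes equations; no item is closed; nothing numerical about the certificate is asserted.

The point of the variant (`…T4W76RDefs`): every datum a kernel replay reads is the same as for `T4W76.frame`, in
particular the `TermPresD 4` of module `…OneShiftT4W76TermPres` (numbering `(i, j) ↦ i + 4j`, exact presentation of the
table, `Λ`-boxes, tube centre boxes `cb i ∋ ĝ ŷ_{i,0}` on shell `−1`, radius literals `⌈g_hi (r₀+κ) 2⁶⁰⌉ 2⁻⁶⁰` /
`4^{|k|}` / `⌈10⁻³⁰ 2¹⁶⁰⌉ 2⁻¹⁶⁰`).  Here: `TermPresD.Frames` for the VARIANT frame (its wake radius `1.03395·(8.16·10⁻⁵ + κ)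
= 1.70891·10⁻⁴` is below the shell-`−1` literal `1.70994·10⁻⁴`, its top radii `ε/16^j` below the top literal) and the
term-data triple `hRDc` / `hRD` / `hTf` of parts XLVI / L for any grid whose steps carry `RD := (presT4 cb).mkRD` — so the
EMITTED replay data of p2 g15 (kit j325299, package T4W76Replay) serve the variant row verbatim.
-/

noncomputable section

-- the sub-problem namespace repeats the summit name by design (D-0017)
set_option linter.dupNamespace false

namespace Summit.NavierStokesRegularity.NavierStokesRegularity.Theorems

namespace DSSOneShift

open Set Finset
open Literature.Analysis.FluidPDE Literature.Analysis.FluidPDE.TaoCascade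
open Summit.NavierStokesRegularity.NavierStokesRegularity.Theorems.TaylorModelCert
open Summit.NavierStokesRegularity.NavierStokesRegularity.Theorems.CertificateGlueOn

namespace T4W76R

open T4W76 (ghat κw cmax εR αT4 BoxData tubeCT4 αT4_pres suppT4 nodup_univT qT4_eq_zero_of_not_mem cenT4 radT4
  presT4 check_presT4 pow_le_two_pow abs_wakeC_le)

/-- The flat numbering `(i, j) ↦ i + 4 j` of the window coordinates of the variant frame. [folklore] -/
def eT4 (bd : BoxData) : (T4W76R.frame bd).SIdx ≃ Fin 304 :=
  ((Equiv.prodComm (Fin 4) (Fin 76)).trans finProdFinEquiv).trans (finCongr (by norm_num))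

/-- Its values. [folklore] -/
theorem eT4_val (bd : BoxData) (i : Fin 4) (j : Fin 76) : ((T4W76R.eT4 bd (i, j) : Fin 304) : ℕ) = (i : ℕ) + 4 * j := rfl

/-- Deeper wake radii of the variant are below `4^n`: `g_hi^n (r₀ + κ n) ≤ 4^n`. [folklore] -/
theorem wakeR_le (n : ℕ) : T4W76R.gHi ^ n * (T4W76R.r₀ + κw * (n : ℝ)) ≤ (4 : ℝ) ^ n := by
  have hg : gHi ^ n ≤ 2 ^ n := pow_le_two_pow (by unfold gHi; norm_num) (by unfold gHi; norm_num) n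
  have hg0 : 0 ≤ gHi ^ n := by unfold gHi; positivity
  have hn : (n : ℝ) ≤ 2 ^ n := by exact_mod_cast Nat.lt_two_pow_self.le
  have h1 : (1 : ℝ) ≤ 2 ^ n := one_le_pow₀ (by norm_num)
  have hr : r₀ + κw * (n : ℝ) ≤ 2 ^ n := by unfold r₀ T4W76.κw; nlinarith
  have hr0 : 0 ≤ r₀ + κw * (n : ℝ) := by unfold r₀ T4W76.κw; positivity
  calc gHi ^ n * (r₀ + κw * (n : ℝ)) ≤ 2 ^ n * 2 ^ n := mul_le_mul hg hr hr0 (by positivity)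
    _ = 4 ^ n := by rw [← mul_pow]; norm_num

/-- **The UNCHANGED presentation `T4W76.presT4 cb` matches the variant frame** (given boxes `cb i ∋ ĝ ŷ_{i,0}` of the wake
centres at shell `−1`). [cite: Tao2016AveragedNS, §4 (4.1), (4.8); cell vocabulary, harvest/h2-tao-ladder rung1/KERNEL-CHEAP-REPLAY-SPEC.md §9 (I)] -/
theorem frames_presT4 (bd : BoxData) (cb : Fin 4 → IntervalD) (hcb : ∀ i, IntervalD.mem (ghat * bd.yc i 0) (cb i)) :
    (presT4 cb).Frames (T4W76R.frame bd) (1 / 10) αT4 (T4W76R.eT4 bd) where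
  hW := rfl
  heN i j := eT4_val bd i j
  hdN i j := by
    have hi := i.isLt
    show (((i : ℕ) + 4 * j) % 4, ((i : ℕ) + 4 * j) / 4) = ((i : ℕ), (j : ℕ))
    ext
    · simp only; omega
    · simp only; omega
  hε := by simp [T4W76.presT4]
  hα i₁ i₂ i μ := αT4_pres i₁ i₂ i μ
  hsupp i i₁ i₂ μ h := by
    rw [αT4_pres, show (presT4 cb).supp = suppT4 from rfl] at *
    rw [qT4_eq_zero_of_not_mem h]; simp
  hnodup i := by
    show (suppT4 i).Nodup
    exact nodup_univT.filter _
  hcen i k hk := by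
    show IntervalD.mem ((T4W76R.frame bd).tubeC i k) (cenT4 cb i k)
    rw [frame_tubeC]
    unfold T4W76.cenT4 T4W76.tubeCT4
    by_cases hk1 : k = -1
    · subst hk1
      simp only [if_true, show (-1 : ℤ) < 0 by norm_num]
      simpa using hcb i
    · rw [if_neg hk1]
      by_cases hk0 : k < 0
      · rw [if_pos hk0, if_pos hk0]
        have hn : ((-k).toNat : ℤ) = -k := by omega
        have h := abs_wakeC_le bd i (-k).toNat
        rw [abs_le] at h
        have e2 : (2 : ℝ) ^ (-k).toNat = (2 : ℝ) ^ (-k) := by rw [← zpow_natCast, hn]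
        rw [e2] at h
        simp only [IntervalD.mem, Dyad.toReal, Int.cast_neg, Int.cast_one, neg_mul, one_mul]
        exact ⟨h.1, h.2⟩
      · rw [if_neg hk0, if_neg hk0]
        exact_mod_cast IntervalD.mem_ofInt 0
  hrad k hk := by
    show (T4W76R.frame bd).tubeR k ≤ (radT4 k).toReal
    rw [frame_tubeR]
    have hk' : ¬ (0 ≤ k ∧ k < 76) := hk
    unfold T4W76.radT4 tubeRT4
    by_cases hk1 : k = -1
    · subst hk1
      simp only [if_true, show (-1 : ℤ) < 0 by norm_num]
      simp only [Dyad.toReal]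
      unfold gHi r₀ T4W76.κw
      norm_num
    · rw [if_neg hk1]
      by_cases hk0 : k < 0
      · rw [if_pos hk0, if_pos hk0]
        have hn : ((-k).toNat : ℤ) = -k := by omega
        have h := wakeR_le (-k).toNat
        have e4 : (4 : ℝ) ^ (-k).toNat = (2 : ℝ) ^ (-2 * k) := by
          rw [show (4 : ℝ) = 2 ^ (2 : ℤ) by norm_num, ← zpow_natCast, ← zpow_mul, hn]; ring_nf
        simp only [Dyad.toReal, Int.cast_one, one_mul]
        rw [← e4]
        exact h
      · have hk76 : 76 ≤ k := by omega
        rw [if_neg hk0, if_neg hk0, if_pos hk76]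
        simp only [Dyad.toReal]
        have hϑ : ϑt ^ (k - 76).toNat ≤ 1 := pow_le_one₀ (by unfold ϑt; norm_num) (by unfold ϑt; norm_num)
        unfold T4W76.εR
        have : (1 : ℝ) / 10 ^ 30 * ϑt ^ (k - 76).toNat ≤ 1 / 10 ^ 30 := by
          have h0 : (0 : ℝ) ≤ 1 / 10 ^ 30 := by positivity
          nlinarith
        refine this.trans ?_
        norm_num

/-- **The term-data hypotheses of `K1_of_grid(C)` for the variant row**, for any grid whose steps all carry
`RD := (presT4 cb).mkRD`: `hRDc`, `hRD` (every admissible realisation, every step, every time) and `hTf`.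
[cite: Tao2016AveragedNS, §4 (4.8); cell vocabulary, harvest/h2-tao-ladder rung1/KERNEL-CHEAP-REPLAY-SPEC.md §9 (I)] -/
theorem termData_presT4 (bd : BoxData) (cb : Fin 4 → IntervalD) (hcb : ∀ i, IntervalD.mem (ghat * bd.yc i 0) (cb i))
    {g : GridD} (hgn : g.n = 304) (hn : ∀ s, (g.step s).n = g.n) (hRD : ∀ s ≤ g.S, (g.step s).RD = (presT4 cb).mkRD)
    (R : ℤ → ℝ) :
    (∀ s ≤ g.S, IsRTEncl (g.es ((eT4 bd).trans (finCongr hgn.symm)) hn s)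
      (TermPresD.centreList (T4W76R.frame bd) (1 / 10) αT4) (TermPresD.centreList (T4W76R.frame bd) (1 / 10) αT4)
      ((presT4 cb).rowsOf (T4W76R.frame bd)) (g.step s).RD) ∧
    (∀ u, (T4W76R.frame bd).AdmLip R u → ∀ s ≤ g.S, ∀ r ∈ Ico 0 (g.h s).toReal,
      IsRTEncl (g.es ((eT4 bd).trans (finCongr hgn.symm)) hn s) (TermPresD.centreList (T4W76R.frame bd) (1 / 10) αT4)
        ((T4W76R.frame bd).wterms (1 / 10) αT4 ((T4W76R.frame bd).preclampTail u) (g.t s + r)) ((presT4 cb).rowsOf (T4W76R.frame bd))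
        (g.step s).RD) ∧
    (∀ u, (T4W76R.frame bd).AdmLip R u → ∀ t x,
      termField ((T4W76R.frame bd).wterms (1 / 10) αT4 ((T4W76R.frame bd).preclampTail u) t) x =
        (T4W76R.frame bd).wfieldFlat (1 / 10) αT4 ((T4W76R.frame bd).preclampTail u) t x) := by
  have hPn : (presT4 cb).n = g.n := by rw [hgn]; rfl
  have S := frames_presT4 bd cb hcb
  have S' : (presT4 cb).Frames (T4W76R.frame bd) (1 / 10) αT4 (((eT4 bd).trans (finCongr hgn.symm)).trans (finCongr hPn.symm)) :=
    { S with heN := fun i j => S.heN i j }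
  exact ⟨TermPresD.hRDc_of_frames hn hPn S' (check_presT4 cb) hRD,
    TermPresD.hRD_of_frames hn hPn S' (check_presT4 cb) hRD R, TermPresD.hTf_wterms R⟩

end T4W76R

end DSSOneShift

end Summit.NavierStokesRegularity.NavierStokesRegularity.Theorems
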